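/-
  Summits/AtomisticToContinuum/Crystallization/Theorems/OverbindingBudgetAffineFarEngineFrame.lean

  residual stmt-AtomisticToContinuum-31280 · slot Z `FarAggregatePricing 12 (1/25) (1/2000) (1/(2·10⁷))` · leaf LAB₁′
  `ShelteredShellLabelling' (1/25) (1/2000)` (leaf list v14′; engine of record rows 899/908/922): E4 part 3 — the ENGINE FRAME:
  R_aff′'s straightening at radius `ρ_R = λR`, read in the Λ-coordinates `x k = B⁻¹(z k − z i)/a₀` that BBI♯/CORE♯ consume, and its
  quantitative consequences (site separation `17/20·nn`, injectivity, own nearest distances).  decomp-a2c lens-4, generation 58.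
  Imports E1b `…FarLatticeFill`, C5 `…FarCoreRechart` and the TREE leaf file `…FarFirstShellLabelling`.
  0 sorry · 0 axiom · no instance · no notation · no option.
-/
import Summits.AtomisticToContinuum.Crystallization.Theorems.OverbindingBudgetAffineFarLatticeFill
import Summits.AtomisticToContinuum.Crystallization.Theorems.OverbindingBudgetAffineFarCoreRechart
import Summits.AtomisticToContinuum.Crystallization.Theorems.OverbindingBudgetAffineFarFirstShellLabelling

/-! # E4 part 3 — the engine frame (PROVED)

`EngineFrame y i ρ_R a₀ τ B x` records what R_aff′ (`AffineChartStraightening'`, applied at radius `ρ_R ≥ 50` around a sheltered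
site `i`) provides, in the coordinates `x k := a₀⁻¹ B⁻¹ (z k − z i)` (`z` the straightened sites, `B` R_aff′'s GLOBAL linear part):
`x i = 0`; `‖y k − y i − a₀ B(x k)‖ ≤ τ·nn` for all `k` (`τ = 2C_R ρ_R² ε₁ ≤ 1/100`); `a₀ ∈ [0.999, 1.001]·nn`; `0.88‖v‖ ≤ ‖Bv‖ ≤ 1.12‖v‖`
and `B` `3θ`-near an isometry; and at every site of the INNER REGION `J = {k : dist(y k, y i) ≤ (ρ_R − 3)·nn}` an EXACT isometric
fcc/hcp two-shell pattern `x k + A(P)` of coordinates of sites, exhaustive for the sites `k' ≠ k` with `‖B(x k' − x k)‖ ≤ 3/2`.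
Consequences (all PROVED): `dist(y k, y i) ≤ (9/8)nn‖x k‖ + nn/100`, `(7/8)nn‖x k‖ ≤ dist(y k, y i) + nn/100`; SEPARATION — a site of
`J` is `≥ (17/20)·nn` from every other site; hence `x` is injective against `J` and `nn_k ≥ (17/20)·nn` on `J`; and the BBI♯ SHELL
HYPOTHESIS for `Λ = x(J)` at norm `≤ ρ_R/2` with exhaustiveness radius `h₀` (finding F-EXH: `1.12·h₀ = 1.4112 ≤ 3/2`).
-/

namespace Summit.AtomisticToContinuum.Crystallization.Theorems.OverbindingBudgetAffineFarSmoothSplit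

open Literature.MathematicalPhysics.StatisticalMechanics
open Literature.Geometry.DiscreteGeometry
open Summit.AtomisticToContinuum.Crystallization.Theorems.OverbindingBudgetAffineLadder
open Summit.AtomisticToContinuum.Crystallization.Theorems.OverbindingBudgetAffineLocalisation
open scoped Classical

/-! ## §1  The frame -/

/-- **The ENGINE FRAME** at the site `i` of `y`, inner radius parameter `ρ_R`, scale `a₀`, closeness `τ`, global linear part `B`,
coordinates `x` (see the module docstring). -/
structure EngineFrame {N : ℕ} (y : Fin N → EuclideanSpace ℝ (Fin 3)) (i : Fin N) (ρR a₀ τ : ℝ)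
    (B : EuclideanSpace ℝ (Fin 3) →ₗ[ℝ] EuclideanSpace ℝ (Fin 3)) (x : Fin N → EuclideanSpace ℝ (Fin 3)) : Prop where
  /-- the central nearest distance is positive -/
  nn_pos : 0 < nearestDist y i
  /-- the radius parameter is at least `50` -/
  ρR_ge : 50 ≤ ρR
  /-- scale, lower bound -/
  a₀_lo : 999 / 1000 * nearestDist y i ≤ a₀
  /-- scale, upper bound -/
  a₀_hi : a₀ ≤ 1001 / 1000 * nearestDist y i
  /-- `B` is `3·(1/25)`-near a linear isometry -/
  B_near : ∃ Q₀ : EuclideanSpace ℝ (Fin 3) →ₗᵢ[ℝ] EuclideanSpace ℝ (Fin 3), ∀ v, ‖B v - Q₀ v‖ ≤ 3 * (1 / 25) * ‖v‖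
  /-- lower operator bound -/
  B_lo : ∀ v, 22 / 25 * ‖v‖ ≤ ‖B v‖
  /-- upper operator bound -/
  B_hi : ∀ v, ‖B v‖ ≤ 28 / 25 * ‖v‖
  /-- closeness parameter, sign -/
  τ_nonneg : 0 ≤ τ
  /-- closeness parameter, size -/
  τ_le : τ ≤ 1 / 100
  /-- the centre has coordinate `0` -/
  x_centre : x i = 0
  /-- every site is `τ·nn`-close to its affine image -/
  close : ∀ k, ‖y k - y i - a₀ • B (x k)‖ ≤ τ * nearestDist y i
  /-- exact isometric two-shell patterns of coordinates at the inner sites, exhaustive within `‖B ·‖ ≤ 3/2` -/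
  pattern : ∀ k, dist (y k) (y i) ≤ (ρR - 3) * nearestDist y i →
    ∃ (A : EuclideanSpace ℝ (Fin 3) →ₗᵢ[ℝ] EuclideanSpace ℝ (Fin 3)) (P : Finset (EuclideanSpace ℝ (Fin 3))),
      (P = fccTwoShellPattern ∨ P = hcpTwoShellPattern) ∧ (∀ v ∈ P, ∃ k', x k' = x k + A v) ∧
      ∀ k', k' ≠ k → ‖B (x k' - x k)‖ ≤ 3 / 2 → ∃ v ∈ P, x k' = x k + A v

/-! ## §2  R_aff′ provides a frame (PROVED) -/

/-- **R_aff′ ⇒ ENGINE FRAME (PROVED).**  With R_aff′'s constant `C_R`, `ρ_R ≥ 50`, `C_R ρ_R² ε₁ ≤ 1/200` and every site within `ρ_R·nn`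
of `y i` good (`δ > 0`), there is a frame with `τ = 2 C_R ρ_R² ε₁`. [this file] -/
theorem exists_engineFrame {C_R : ℝ} (hC_R : 0 ≤ C_R)
    (hRaff : ∀ (ρ ε₁ θ : ℝ), 4 ≤ ρ → 0 < ε₁ → 0 ≤ θ → θ ≤ 1 / 25 → C_R * ρ ^ 2 * ε₁ ≤ 1 / 100 →
      ∀ (N : ℕ) (y : Fin N → EuclideanSpace ℝ (Fin 3)) (i : Fin N), Function.Injective y → AffDeepReg ρ ε₁ θ (1 / 450) y i →
        ∃ (a₀ : ℝ) (B : EuclideanSpace ℝ (Fin 3) →ₗ[ℝ] EuclideanSpace ℝ (Fin 3))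
          (Q₀ : EuclideanSpace ℝ (Fin 3) →ₗᵢ[ℝ] EuclideanSpace ℝ (Fin 3)) (z : Fin N → EuclideanSpace ℝ (Fin 3)),
          |a₀ - nearestDist y i| ≤ C_R * ε₁ * nearestDist y i ∧ (∀ v, ‖B v - Q₀ v‖ ≤ (2 * θ + C_R * ε₁) * ‖v‖) ∧
          (∀ j, dist (z j) (y j) ≤ C_R * ρ ^ 2 * ε₁ * nearestDist y i) ∧
          ∀ j, dist (y j) (y i) ≤ (ρ - 3) * nearestDist y i →
            ∃ (A : EuclideanSpace ℝ (Fin 3) →ₗᵢ[ℝ] EuclideanSpace ℝ (Fin 3)) (P : Finset (EuclideanSpace ℝ (Fin 3))),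
              (P = fccTwoShellPattern ∨ P = hcpTwoShellPattern) ∧ (∀ v ∈ P, ∃ k, z k = z j + a₀ • B (A v)) ∧
              ∀ k, k ≠ j → dist (z k) (z j) ≤ 3 / 2 * a₀ → ∃ v ∈ P, z k = z j + a₀ • B (A v))
    {ε₁ : ℝ} (hε₁ : 0 < ε₁) {ρR : ℝ} (hρR : 50 ≤ ρR) (hτ : C_R * ρR ^ 2 * ε₁ ≤ 1 / 200)
    {N : ℕ} {y : Fin N → EuclideanSpace ℝ (Fin 3)} (hy : Function.Injective y) {i : Fin N} {δ : ℝ} (hδ : 0 < δ)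
    (hSh : ∀ k, dist (y k) (y i) ≤ ρR * nearestDist y i → k ∈ goodSet 12 ε₁ (1 / 25) δ y) :
    ∃ (a₀ : ℝ) (B : EuclideanSpace ℝ (Fin 3) →ₗ[ℝ] EuclideanSpace ℝ (Fin 3)) (x : Fin N → EuclideanSpace ℝ (Fin 3)),
      EngineFrame y i ρR a₀ (2 * C_R * ρR ^ 2 * ε₁) B x := by
  have hiG : i ∈ goodSet 12 ε₁ (1 / 25) δ y :=
    hSh i (by rw [dist_self]; exact mul_nonneg (by linarith) (nearestDist_nonneg y i))
  have hnn : 0 < nearestDist y i := lt_of_lt_of_le hδ (inWindow_of_mem_goodSet hiG).1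
  have hdeep : AffDeepReg ρR ε₁ (1 / 25) (1 / 450) y i := by
    intro i' hi'
    have hG := hSh i' hi'
    unfold goodSet at hG
    rw [Finset.mem_filter] at hG
    exact hG.2.1 i' (by rw [dist_self]; exact mul_nonneg (by norm_num) (nearestDist_nonneg y i'))
  obtain ⟨a₀, B, Q₀, z, ha₀, hB, hz, hpat⟩ :=
    hRaff ρR ε₁ (1 / 25) (by linarith) hε₁ (by norm_num) le_rfl (by linarith) N y i hy hdeep
  set nn := nearestDist y i with hnn_def
  have hCε : C_R * ε₁ ≤ 1 / 1000 := by
    have h1 : 0 ≤ C_R * ε₁ := mul_nonneg hC_R hε₁.le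
    have h2 : C_R * ε₁ * 2500 ≤ C_R * ε₁ * ρR ^ 2 := mul_le_mul_of_nonneg_left (by nlinarith) h1
    nlinarith
  have hCεnn : C_R * ε₁ * nn ≤ 1 / 1000 * nn := mul_le_mul_of_nonneg_right hCε hnn.le
  have ha_lo : 999 / 1000 * nn ≤ a₀ := by have := (abs_le.1 ha₀).1; linarith
  have ha_hi : a₀ ≤ 1001 / 1000 * nn := by have := (abs_le.1 ha₀).2; linarith
  have ha_pos : 0 < a₀ := by linarith
  have hBnear : ∃ Q₀ : EuclideanSpace ℝ (Fin 3) →ₗᵢ[ℝ] EuclideanSpace ℝ (Fin 3), ∀ v, ‖B v - Q₀ v‖ ≤ 3 * (1 / 25) * ‖v‖ :=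
    ⟨Q₀, fun v => (hB v).trans (mul_le_mul_of_nonneg_right (by linarith) (norm_nonneg v))⟩
  obtain ⟨hlo, hhi⟩ := near_iso_bounds hBnear
  have hinj : Function.Injective B := by
    intro u w h
    have h1 := hlo (u - w)
    rw [map_sub, h, sub_self, norm_zero] at h1
    have h2 : ‖u - w‖ = 0 := le_antisymm (by linarith) (norm_nonneg _)
    exact sub_eq_zero.1 (norm_eq_zero.1 h2)
  set Be := LinearEquiv.ofInjectiveEndo B hinj with hBe
  have hBe_app : ∀ v, Be v = B v := fun v => rfl
  -- the coordinates
  refine ⟨a₀, B, fun k => a₀⁻¹ • Be.symm (z k - z i), ?_⟩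
  have hxB : ∀ k, a₀ • B (a₀⁻¹ • Be.symm (z k - z i)) = z k - z i := by
    intro k
    rw [map_smul, ← hBe_app, Be.apply_symm_apply, smul_smul, mul_inv_cancel₀ ha_pos.ne', one_smul]
  have hBinj' : ∀ u w : EuclideanSpace ℝ (Fin 3), a₀ • B u = a₀ • B w → u = w :=
    fun u w h => hinj (smul_right_injective _ ha_pos.ne' h)
  -- coordinates of a pattern step
  have hstep : ∀ (k k' : Fin N) (w : EuclideanSpace ℝ (Fin 3)), z k' = z k + a₀ • B w →
      a₀⁻¹ • Be.symm (z k' - z i) = a₀⁻¹ • Be.symm (z k - z i) + w := by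
    intro k k' w h
    apply hBinj'
    rw [map_add, smul_add, hxB, hxB, h]
    abel
  refine
    { nn_pos := hnn, ρR_ge := hρR, a₀_lo := ha_lo, a₀_hi := ha_hi, B_near := hBnear, B_lo := hlo, B_hi := hhi,
      τ_nonneg := ?_, τ_le := by linarith, x_centre := by rw [sub_self, map_zero, smul_zero], close := ?_, pattern := ?_ }
  · exact mul_nonneg (mul_nonneg (mul_nonneg (by norm_num) hC_R) (sq_nonneg _)) hε₁.le
  · intro k
    rw [hxB]
    have e : y k - y i - (z k - z i) = (y k - z k) + (z i - y i) := by abel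
    rw [e]
    refine (norm_add_le _ _).trans ?_
    rw [← dist_eq_norm, ← dist_eq_norm, dist_comm]
    linarith [hz k, hz i]
  · intro k hk
    obtain ⟨A, P, hP, hmem, hexh⟩ := hpat k hk
    refine ⟨A, P, hP, fun v hv => ?_, fun k' hne hd => ?_⟩
    · obtain ⟨k', hk'⟩ := hmem v hv
      exact ⟨k', hstep k k' (A v) hk'⟩
    · have hdz : dist (z k') (z k) ≤ 3 / 2 * a₀ := by
        have e : z k' - z k = a₀ • B (a₀⁻¹ • Be.symm (z k' - z i)) - a₀ • B (a₀⁻¹ • Be.symm (z k - z i)) := by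
          rw [hxB, hxB]; abel
        rw [dist_eq_norm, e, ← smul_sub, ← map_sub, norm_smul, Real.norm_eq_abs, abs_of_pos ha_pos]
        have := mul_le_mul_of_nonneg_left hd ha_pos.le
        linarith
      obtain ⟨v, hv, hk'⟩ := hexh k' hne hdz
      exact ⟨v, hv, hstep k k' (A v) hk'⟩

/-! ## §3  Consequences of the frame (PROVED) -/

namespace EngineFrame

variable {N : ℕ} {y : Fin N → EuclideanSpace ℝ (Fin 3)} {i : Fin N} {ρR a₀ τ : ℝ}
  {B : EuclideanSpace ℝ (Fin 3) →ₗ[ℝ] EuclideanSpace ℝ (Fin 3)} {x : Fin N → EuclideanSpace ℝ (Fin 3)}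

/-- The scale is positive. [this file] -/
theorem a₀_pos (hF : EngineFrame y i ρR a₀ τ B x) : 0 < a₀ := by
  linarith [hF.a₀_lo, hF.nn_pos]

/-- `a₀‖B w‖ ≤ (9/8)·nn·‖w‖`. [this file] -/
theorem smul_norm_le (hF : EngineFrame y i ρR a₀ τ B x) (w : EuclideanSpace ℝ (Fin 3)) :
    ‖a₀ • B w‖ ≤ 9 / 8 * nearestDist y i * ‖w‖ := by
  rw [norm_smul, Real.norm_eq_abs, abs_of_pos hF.a₀_pos]
  have h1 := mul_le_mul hF.a₀_hi (hF.B_hi w) (norm_nonneg _) (by linarith [hF.nn_pos])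
  have h2 : 0 ≤ nearestDist y i * ‖w‖ := mul_nonneg hF.nn_pos.le (norm_nonneg w)
  linarith

/-- `(7/8)·nn·‖w‖ ≤ a₀‖B w‖`. [this file] -/
theorem le_smul_norm (hF : EngineFrame y i ρR a₀ τ B x) (w : EuclideanSpace ℝ (Fin 3)) :
    7 / 8 * nearestDist y i * ‖w‖ ≤ ‖a₀ • B w‖ := by
  rw [norm_smul, Real.norm_eq_abs, abs_of_pos hF.a₀_pos]
  have h1 := mul_le_mul hF.a₀_lo (hF.B_lo w) (by positivity) hF.a₀_pos.le
  have h2 : 0 ≤ nearestDist y i * ‖w‖ := mul_nonneg hF.nn_pos.le (norm_nonneg w)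
  linarith

/-- Distances from the centre are read off the coordinates: `dist(y k, y i) ≤ (9/8)nn‖x k‖ + nn/100`. [this file] -/
theorem dist_le (hF : EngineFrame y i ρR a₀ τ B x) (k : Fin N) :
    dist (y k) (y i) ≤ 9 / 8 * nearestDist y i * ‖x k‖ + 1 / 100 * nearestDist y i := by
  have h1 := hF.close k
  have h2 := hF.smul_norm_le (x k)
  have h3 : ‖y k - y i‖ ≤ ‖y k - y i - a₀ • B (x k)‖ + ‖a₀ • B (x k)‖ := by
    have := norm_add_le (y k - y i - a₀ • B (x k)) (a₀ • B (x k))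
    rwa [sub_add_cancel] at this
  have h4 : τ * nearestDist y i ≤ 1 / 100 * nearestDist y i := mul_le_mul_of_nonneg_right hF.τ_le hF.nn_pos.le
  rw [dist_eq_norm]
  linarith

/-- … and conversely `(7/8)nn‖x k‖ ≤ dist(y k, y i) + nn/100`. [this file] -/
theorem norm_le (hF : EngineFrame y i ρR a₀ τ B x) (k : Fin N) :
    7 / 8 * nearestDist y i * ‖x k‖ ≤ dist (y k) (y i) + 1 / 100 * nearestDist y i := by
  have h1 := hF.close k
  have h2 := hF.le_smul_norm (x k)
  have h3 : ‖a₀ • B (x k)‖ ≤ ‖y k - y i‖ + ‖y k - y i - a₀ • B (x k)‖ := by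
    have := norm_sub_le (y k - y i) (y k - y i - a₀ • B (x k))
    rwa [sub_sub_cancel] at this
  have h4 : τ * nearestDist y i ≤ 1 / 100 * nearestDist y i := mul_le_mul_of_nonneg_right hF.τ_le hF.nn_pos.le
  rw [dist_eq_norm]
  linarith

/-- The difference of two sites against the affine image of the coordinate difference: `≤ 2τ·nn ≤ nn/50`. [this file] -/
theorem norm_sub_sub_le (hF : EngineFrame y i ρR a₀ τ B x) (k k' : Fin N) :
    ‖y k' - y k - a₀ • B (x k' - x k)‖ ≤ 1 / 50 * nearestDist y i := by
  have e : y k' - y k - a₀ • B (x k' - x k) = (y k' - y i - a₀ • B (x k')) - (y k - y i - a₀ • B (x k)) := by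
    rw [map_sub, smul_sub]; abel
  rw [e]
  refine (norm_sub_le _ _).trans ?_
  have h4 : τ * nearestDist y i ≤ 1 / 100 * nearestDist y i := mul_le_mul_of_nonneg_right hF.τ_le hF.nn_pos.le
  linarith [hF.close k, hF.close k']

/-- **SEPARATION**: an inner site is at distance `≥ (17/20)·nn` from every other site. [this file] -/
theorem sep (hF : EngineFrame y i ρR a₀ τ B x) {k k' : Fin N} (hk : dist (y k) (y i) ≤ (ρR - 3) * nearestDist y i)
    (hne : k' ≠ k) : 17 / 20 * nearestDist y i ≤ dist (y k') (y k) := by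
  have hnn := hF.nn_pos
  -- the affine image of the coordinate difference is long
  have hlong : 7 / 8 * nearestDist y i ≤ ‖a₀ • B (x k' - x k)‖ := by
    by_cases hd : ‖B (x k' - x k)‖ ≤ 3 / 2
    · obtain ⟨A, P, hP, -, hexh⟩ := hF.pattern k hk
      obtain ⟨v, hv, hv'⟩ := hexh k' hne hd
      have hv1 : 1 ≤ ‖v‖ := by
        have hn : ‖v‖ = 1 ∨ ‖v‖ = Real.sqrt 2 := by
          rcases hP with rfl | rfl
          exacts [norm_of_mem_fccTwoShellPattern hv, norm_of_mem_hcpTwoShellPattern hv]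
        rcases hn with h | h
        · rw [h]
        · rw [h]; exact Real.one_le_sqrt.2 (by norm_num)
      rw [hv', add_sub_cancel_left]
      have h1 := hF.le_smul_norm (A v)
      rw [A.norm_map] at h1
      nlinarith [hF.nn_pos]
    · push Not at hd
      rw [norm_smul, Real.norm_eq_abs, abs_of_pos hF.a₀_pos]
      have h1 := mul_le_mul hF.a₀_lo hd.le (by norm_num) hF.a₀_pos.le
      linarith
  have h2 := hF.norm_sub_sub_le k k'
  have h3 : ‖a₀ • B (x k' - x k)‖ ≤ ‖y k' - y k‖ + ‖y k' - y k - a₀ • B (x k' - x k)‖ := by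
    have := norm_sub_le (y k' - y k) (y k' - y k - a₀ • B (x k' - x k))
    rwa [sub_sub_cancel] at this
  rw [dist_eq_norm]
  linarith

/-- **INJECTIVITY** of the coordinates against the inner region. [this file] -/
theorem inj (hF : EngineFrame y i ρR a₀ τ B x) {k k' : Fin N} (hk : dist (y k) (y i) ≤ (ρR - 3) * nearestDist y i)
    (hx : x k' = x k) : k' = k := by
  by_contra hne
  have h1 := hF.sep hk hne
  have h2 := hF.norm_sub_sub_le k k'
  rw [hx, sub_self, map_zero, smul_zero, sub_zero, ← dist_eq_norm] at h2
  linarith [hF.nn_pos]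

/-- An inner site has another site (a pattern partner). [this file] -/
theorem exists_ne (hF : EngineFrame y i ρR a₀ τ B x) {k : Fin N} (hk : dist (y k) (y i) ≤ (ρR - 3) * nearestDist y i) :
    ∃ k' : Fin N, k' ≠ k := by
  obtain ⟨A, P, hP, hmem, -⟩ := hF.pattern k hk
  obtain ⟨hcard, -⟩ := ncard_kissing_eq_twelve hP
  obtain ⟨v, hvP, hv1⟩ := Set.nonempty_of_ncard_ne_zero
    (s := {v : EuclideanSpace ℝ (Fin 3) | v ∈ P ∧ ‖v‖ = 1}) (by rw [hcard]; norm_num)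
  obtain ⟨k', hk'⟩ := hmem v hvP
  refine ⟨k', fun h => ?_⟩
  rw [h, left_eq_add] at hk'
  have : ‖v‖ = 0 := by rw [← A.norm_map, hk', norm_zero]
  rw [hv1] at this
  exact one_ne_zero this

/-- **OWN NEAREST DISTANCES** on the inner region: `(17/20)·nn ≤ nn_k`. [this file] -/
theorem nn_ge (hF : EngineFrame y i ρR a₀ τ B x) {k : Fin N} (hk : dist (y k) (y i) ≤ (ρR - 3) * nearestDist y i) :
    17 / 20 * nearestDist y i ≤ nearestDist y k :=
  le_nearestDist (hF.exists_ne hk) fun k' hne => by rw [dist_comm]; exact hF.sep hk hne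

/-- A pattern step from an inner site of coordinate norm `≤ ρ_R/2` stays in the inner region. [this file] -/
theorem inner_of_step (hF : EngineFrame y i ρR a₀ τ B x) {k k' : Fin N} (hxk : ‖x k‖ ≤ ρR / 2)
    {w : EuclideanSpace ℝ (Fin 3)} (hw : ‖w‖ ≤ 3 / 2) (hk' : x k' = x k + w) :
    dist (y k') (y i) ≤ (ρR - 3) * nearestDist y i := by
  have h1 := hF.dist_le k'
  have h2 : ‖x k'‖ ≤ ρR / 2 + 3 / 2 := by rw [hk']; exact (norm_add_le _ _).trans (by linarith)
  have h3 := mul_le_mul_of_nonneg_left h2 (show 0 ≤ 9 / 8 * nearestDist y i by linarith [hF.nn_pos])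
  nlinarith [hF.nn_pos, hF.ρR_ge]

/-- **The BBI♯ SHELL HYPOTHESIS for `Λ = x(J)`** at norm `≤ ρ_R/2`, exhaustiveness radius `h₀` (finding F-EXH). [this file] -/
theorem shell (hF : EngineFrame y i ρR a₀ τ B x) :
    ∀ x₀ ∈ x '' {k | dist (y k) (y i) ≤ (ρR - 3) * nearestDist y i}, ‖x₀‖ ≤ ρR / 2 →
      ∃ (A : EuclideanSpace ℝ (Fin 3) →ₗᵢ[ℝ] EuclideanSpace ℝ (Fin 3)) (P : Finset (EuclideanSpace ℝ (Fin 3))),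
        (P = fccTwoShellPattern ∨ P = hcpTwoShellPattern) ∧
        (∀ v ∈ P, x₀ + A v ∈ x '' {k | dist (y k) (y i) ≤ (ρR - 3) * nearestDist y i}) ∧
        ∀ x' ∈ x '' {k | dist (y k) (y i) ≤ (ρR - 3) * nearestDist y i}, x' ≠ x₀ → dist x' x₀ < hales_h0 →
          ∃ v ∈ P, x' = x₀ + A v := by
  rintro x₀ ⟨k, hk, rfl⟩ hxk
  obtain ⟨A, P, hP, hmem, hexh⟩ := hF.pattern k hk
  refine ⟨A, P, hP, fun v hv => ?_, ?_⟩
  · obtain ⟨k', hk'⟩ := hmem v hv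
    have hv32 : ‖A v‖ ≤ 3 / 2 := by
      rw [A.norm_map]
      have hn : ‖v‖ = 1 ∨ ‖v‖ = Real.sqrt 2 := by
        rcases hP with rfl | rfl
        exacts [norm_of_mem_fccTwoShellPattern hv, norm_of_mem_hcpTwoShellPattern hv]
      rcases hn with h | h
      · rw [h]; norm_num
      · rw [h]; exact Real.sqrt_le_iff.2 ⟨by norm_num, by norm_num⟩
    exact ⟨k', hF.inner_of_step hxk hv32 hk', hk'⟩
  · rintro x' ⟨k', hk', rfl⟩ hne hd
    have hne' : k' ≠ k := fun h => hne (by rw [h])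
    have hB : ‖B (x k' - x k)‖ ≤ 3 / 2 := by
      have h1 := hF.B_hi (x k' - x k)
      rw [← dist_eq_norm] at h1
      rw [hales_h0_eq] at hd
      linarith
    exact hexh k' hne' hB

end EngineFrame

end Summit.AtomisticToContinuum.Crystallization.Theorems.OverbindingBudgetAffineFarSmoothSplit
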